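import Summits.RiemannHypothesis.RiemannHypothesis.Theorems.SignConeSignConeOscillatoryDualWitnessDefs
import Literature.NumberTheory.LFunctions.WeilArchimedeanMoments
import Literature.NumberTheory.LFunctions.WeilGroundState
import Literature.Analysis.Fourier.PaleyWienerHalfPlane
import Mathlib.Analysis.Fourier.Convolution

/-!
# Stub `stub_extremalExists` (line `dual_witness` of crux `SignConeOscillatory`, stmt-RiemannHypothesis-16302), I:
# the `L²` toolkit for autocorrelations on a window

The registered stub `stub_extremalExists : SignConeExtremalExists` is proved (files `…StubExtremalExists*.lean`) by
taking an `L²`-limit `u` of a minimising sequence of test functions `gₙ` on the window `[-a, a]` (compactness of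
the form embedding, `ConnesConsaniMoscovici2025_thm_3_6_holds`).  This file supplies what passes to such a limit:

* `autocorr_apply`, `autocorr_zero_re` (`Re (u ⋆ ũ)(0) = ∫ |u|²`), `autocorr_eq_zero_of_lt` (`u ⋆ ũ = 0` off
  `[-2a, 2a]` when `supp u ⊆ [-a, a]`);
* Cauchy–Schwarz: `norm_autocorr_sub_autocorr_le` (`|u⋆ũ(t) − v⋆ṽ(t)| ≤ ‖u − v‖₂ (‖u‖₂ + ‖v‖₂)`), hence node values
  converge along `L²`-convergent sequences (`tendsto_autocorr`), and `|u ⋆ ũ(t)| ≤ ‖u‖₂²` (`norm_autocorr_le`);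
* the critical line: `norm_weilMellin_half_sub_le` (`|û(1/2+it) − v̂(1/2+it)| ≤ √(2a) ‖u − v‖₂`),
  `weilMellin_autocorr_half` (`(u ⋆ ũ)^(1/2+it) = |û(1/2+it)|²` for `u ∈ L¹`, Mathlib's convolution theorem) and
  Plancherel `∫ |û(1/2+it)|² dt = 2π ∫ |u|²` for `u ∈ L¹ ∩ L²` (the tree's `integral_norm_sq_weilMellin_half_line`,
  verbatim proof, hypothesis weakened from `IsWeilTest`).

Here `‖u‖₂ = (eLpNorm u 2).toReal`, `autocorr`, `weilMellin` as in the line's vocabulary / `WeilExplicit`.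
-/

noncomputable section

-- `Summit.RiemannHypothesis.RiemannHypothesis.…` repeats a namespace component by design (D-0017 layout).
set_option linter.dupNamespace false

open scoped BigOperators ComplexConjugate Topology FourierTransform ENNReal
open MeasureTheory Set Filter Complex

namespace Summit.RiemannHypothesis.RiemannHypothesis.Theorems.SignCone.DualWitness

open Literature.NumberTheory.LFunctions

/-- Shorthand: the `L²` norm as a real number. [folklore] -/
local notation "N₂" u:arg => ENNReal.toReal (eLpNorm u 2 MeasureTheory.MeasureSpace.volume)

variable {a : ℝ} {u v : ℝ → ℂ}

/-! ## Pointwise formulas -/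

/-- `(u ⋆ ũ)(t) = ∫ u(s) conj (u(s - t)) ds`. [folklore] -/
theorem autocorr_apply (u : ℝ → ℂ) (t : ℝ) : autocorr u t = ∫ s, u s * conj (u (s - t)) := by
  simp [autocorr, convolution_def, neg_sub]

/-- `Re (u ⋆ ũ)(0) = ∫ |u|²` (junk-safe). [folklore] -/
theorem autocorr_zero_re (u : ℝ → ℂ) : (autocorr u 0).re = ∫ x, ‖u x‖ ^ 2 := by
  rw [autocorr_apply]
  simp only [sub_zero, mul_conj, normSq_eq_norm_sq]
  rw [integral_complex_ofReal, Complex.ofReal_re]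

/-- If `supp u ⊆ [-a, a]` then `(u ⋆ ũ)(t) = 0` for `|t| > 2a` (the integrand vanishes identically). [folklore] -/
theorem autocorr_eq_zero_of_lt (hsu : Function.support u ⊆ Icc (-a) a) {t : ℝ} (ht : 2 * a < |t|) :
    autocorr u t = 0 := by
  rw [autocorr_apply]
  refine integral_eq_zero_of_ae (Eventually.of_forall fun s => ?_)
  by_cases hs : u s = 0
  · simp [hs]
  · have h1 := hsu (Function.mem_support.mpr hs)
    have h2 : u (s - t) = 0 := by
      by_contra h
      have h3 := hsu (Function.mem_support.mpr h)
      rcases lt_abs.mp ht with h4 | h4 <;> linarith [h1.1, h1.2, h3.1, h3.2]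
    simp [h2]

/-! ## `L²` bookkeeping -/

/-- Translates of `L²` functions are `L²` with the same norm. [folklore] -/
theorem memLp_comp_sub_right (hv : MemLp v 2 volume) (t : ℝ) : MemLp (fun s => v (s - t)) 2 volume :=
  hv.comp_measurePreserving (measurePreserving_sub_right volume t)

/-- `conj ∘` preserves `L²`. [folklore] -/
theorem memLp_conj (hv : MemLp v 2 volume) : MemLp (fun s => conj (v s)) 2 volume :=
  hv.congr_norm (Complex.continuous_conj.comp_aestronglyMeasurable hv.1) (Eventually.of_forall fun _ => by
    rw [norm_conj])

/-- `‖conj (v (· - t))‖₂ = ‖v‖₂`. [folklore] -/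
theorem eLpNorm_conj_comp_sub_right (hv : MemLp v 2 volume) (t : ℝ) :
    eLpNorm (fun s => conj (v (s - t))) 2 volume = eLpNorm v 2 volume := by
  have h1 : eLpNorm (fun s => conj (v (s - t))) 2 volume = eLpNorm (fun s => v (s - t)) 2 volume :=
    eLpNorm_congr_norm_ae (Eventually.of_forall fun _ => by simp)
  rw [h1, show (fun s => v (s - t)) = v ∘ (fun s => s - t) from rfl]
  exact eLpNorm_comp_measurePreserving hv.1 (measurePreserving_sub_right volume t)

/-- Products of `L²` functions are integrable. [folklore] -/
theorem integrable_mul_of_memLp_two (hu : MemLp u 2 volume) (hv : MemLp v 2 volume) :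
    Integrable (fun s => u s * v s) := by
  refine (Literature.Analysis.Fourier.integrable_norm_mul_norm_of_memLp_two hu hv).mono' (hu.1.mul hv.1)
    (Eventually.of_forall fun s => ?_)
  rw [norm_mul]

/-- `L²` with support in the window is `L¹`. [folklore] -/
theorem integrable_of_memLp_two_of_support (hu : MemLp u 2 volume) (hsu : Function.support u ⊆ Icc (-a) a) :
    Integrable u :=
  memLp_one_iff_integrable.mp (hu.mono_exponent_of_measure_support_ne_top
    (fun x hx => Function.notMem_support.mp fun h => hx (hsu h)) measure_Icc_lt_top.ne (by norm_num))

/-! ## Cauchy–Schwarz -/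

/-- `|∫ u · conj (v(· - t))| ≤ ‖u‖₂ ‖v‖₂`. [folklore] -/
theorem norm_integral_mul_conj_sub_le (hu : MemLp u 2 volume) (hv : MemLp v 2 volume) (t : ℝ) :
    ‖∫ s, u s * conj (v (s - t))‖ ≤ N₂ u * N₂ v := by
  have h := Literature.Analysis.Fourier.norm_integral_mul_le_eLpNorm_mul hu
    (memLp_conj (memLp_comp_sub_right hv t))
  rwa [eLpNorm_conj_comp_sub_right hv t] at h

/-- `|(u ⋆ ũ)(t)| ≤ ‖u‖₂²`. [folklore] -/
theorem norm_autocorr_le (hu : MemLp u 2 volume) (t : ℝ) : ‖autocorr u t‖ ≤ N₂ u * N₂ u := by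
  rw [autocorr_apply]; exact norm_integral_mul_conj_sub_le hu hu t

/-- **Cauchy–Schwarz continuity of the autocorrelation in `L²`**:
`|(u ⋆ ũ)(t) − (v ⋆ ṽ)(t)| ≤ ‖u − v‖₂ (‖u‖₂ + ‖v‖₂)`. [folklore] -/
theorem norm_autocorr_sub_autocorr_le (hu : MemLp u 2 volume) (hv : MemLp v 2 volume) (t : ℝ) :
    ‖autocorr u t - autocorr v t‖ ≤ N₂ (u - v) * (N₂ u + N₂ v) := by
  have huv : MemLp (u - v) 2 volume := hu.sub hv
  have e : autocorr u t - autocorr v t =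
      (∫ s, (u - v) s * conj (u (s - t))) + ∫ s, v s * conj ((u - v) (s - t)) := by
    rw [autocorr_apply, autocorr_apply,
      ← integral_sub (integrable_mul_of_memLp_two hu (memLp_conj (memLp_comp_sub_right hu t)))
        (integrable_mul_of_memLp_two hv (memLp_conj (memLp_comp_sub_right hv t))),
      ← integral_add (integrable_mul_of_memLp_two huv (memLp_conj (memLp_comp_sub_right hu t)))
        (integrable_mul_of_memLp_two hv (memLp_conj (memLp_comp_sub_right huv t)))]
    refine integral_congr_ae (Eventually.of_forall fun s => ?_)
    simp only [Pi.sub_apply, map_sub]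
    ring
  rw [e]
  calc ‖(∫ s, (u - v) s * conj (u (s - t))) + ∫ s, v s * conj ((u - v) (s - t))‖
      ≤ ‖∫ s, (u - v) s * conj (u (s - t))‖ + ‖∫ s, v s * conj ((u - v) (s - t))‖ := norm_add_le _ _
    _ ≤ N₂ (u - v) * N₂ u + N₂ v * N₂ (u - v) :=
        add_le_add (norm_integral_mul_conj_sub_le huv hu t) (norm_integral_mul_conj_sub_le hv huv t)
    _ = N₂ (u - v) * (N₂ u + N₂ v) := by ring

/-- `‖·‖₂` as a square root: `(eLpNorm f 2).toReal = √(∫ |f|²)`. [folklore] -/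
theorem toReal_eLpNorm_two_eq_sqrt {f : ℝ → ℂ} (hf : MemLp f 2 volume) :
    N₂ f = Real.sqrt (∫ t, ‖f t‖ ^ 2) := by
  rw [eLpNorm_two_eq_ofReal_sqrt hf, ENNReal.toReal_ofReal (Real.sqrt_nonneg _)]

/-- **Node values pass to `L²`-limits**: if `∫ |gₙ − u|² → 0` then `(gₙ ⋆ g̃ₙ)(t) → (u ⋆ ũ)(t)` for every `t`.
[folklore] -/
theorem tendsto_autocorr : ∀ {u : ℝ → ℂ} {g : ℕ → ℝ → ℂ}, (∀ n, MemLp (g n) 2 volume) → MemLp u 2 volume → Tendsto (fun n => ∫ x, ‖g n x - u x‖ ^ 2) atTop (𝓝 0) → ∀ t : ℝ, Tendsto (fun n => autocorr (g n) t) atTop (𝓝 (autocorr u t)) := by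
  intro u g hg hu hlim t
  have hd : Tendsto (fun n => N₂ (g n - u)) atTop (𝓝 0) := by
    have h1 : Tendsto (fun n => Real.sqrt (∫ x, ‖g n x - u x‖ ^ 2)) atTop (𝓝 0) := by
      have h := (Real.continuous_sqrt.tendsto 0).comp hlim
      rw [Real.sqrt_zero] at h
      exact h
    refine h1.congr fun n => ?_
    rw [toReal_eLpNorm_two_eq_sqrt ((hg n).sub hu)]; rfl
  -- `‖gₙ‖₂ ≤ ‖u‖₂ + ‖gₙ − u‖₂`
  have hbd : ∀ n, N₂ (g n) ≤ N₂ u + N₂ (g n - u) := by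
    intro n
    have h := eLpNorm_add_le hu.1 ((hg n).sub hu).1 (one_le_two : (1 : ℝ≥0∞) ≤ 2) (μ := volume)
    have e : u + (g n - u) = g n := by funext x; simp
    rw [e] at h
    have hfin : eLpNorm u 2 volume + eLpNorm (g n - u) 2 volume ≠ ∞ :=
      ENNReal.add_ne_top.mpr ⟨hu.eLpNorm_ne_top, ((hg n).sub hu).eLpNorm_ne_top⟩
    rw [← ENNReal.toReal_add hu.eLpNorm_ne_top ((hg n).sub hu).eLpNorm_ne_top]
    exact (ENNReal.toReal_le_toReal (hg n).eLpNorm_ne_top hfin).mpr h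
  rw [tendsto_iff_norm_sub_tendsto_zero]
  refine squeeze_zero (fun n => norm_nonneg _)
    (fun n => (norm_autocorr_sub_autocorr_le (hg n) hu t).trans
      (mul_le_mul_of_nonneg_left (add_le_add (hbd n) le_rfl) ENNReal.toReal_nonneg)) ?_
  have : Tendsto (fun n => N₂ (g n - u) * (N₂ u + N₂ (g n - u) + N₂ u)) atTop (𝓝 (0 * (N₂ u + 0 + N₂ u))) :=
    hd.mul ((tendsto_const_nhds.add hd).add tendsto_const_nhds)
  simpa using this

/-! ## The critical line -/

/-- `ĝ(1/2 + it) = 𝓕 g (−t/2π)` (the tree's dictionary `fourier_weilKernel`). [folklore] -/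
theorem weilMellin_half_eq_fourier (g : ℝ → ℂ) (t : ℝ) :
    weilMellin g (1 / 2 + t * I) = 𝓕 g (-t / (2 * Real.pi)) := by
  have h := fourier_weilKernel g (1 / 2) (-t / (2 * Real.pi))
  have e : (fun x : ℝ => g x * cexp ((((1 / 2 : ℝ) : ℂ) - 1 / 2) * x)) = g := by
    funext x; push_cast; simp
  rw [e] at h
  rw [h]
  congr 1
  have hpi : (Real.pi : ℝ) ≠ 0 := Real.pi_ne_zero
  push_cast
  field_simp

/-- **`(u ⋆ ũ)^(1/2 + it) = |û(1/2 + it)|²`** for integrable `u` (Mathlib's convolution theorem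
`Real.fourier_mul_convolution_eq` and `𝓕 ũ = conj ∘ 𝓕 u`). [folklore] -/
theorem weilMellin_autocorr_half (hi : Integrable u) (t : ℝ) :
    weilMellin (autocorr u) (1 / 2 + t * I) = ((‖weilMellin u (1 / 2 + t * I)‖ ^ 2 : ℝ) : ℂ) := by
  have hconj : ∀ ξ : ℝ, 𝓕 (fun x => conj (u (-x))) ξ = conj (𝓕 u ξ) := by
    intro ξ
    rw [Real.fourier_real_eq, Real.fourier_real_eq, ← integral_conj,
      ← integral_neg_eq_self (fun v : ℝ => 𝐞 (-(v * ξ)) • conj (u (-v))) volume]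
    refine integral_congr_ae (Eventually.of_forall fun v => ?_)
    have hc : conj ((𝐞 (-(v * ξ)) : ℂ)) = (𝐞 (-(-v * ξ)) : ℂ) := by
      rw [Real.fourierChar_apply, Real.fourierChar_apply, ← Complex.exp_conj, map_mul, Complex.conj_ofReal,
        Complex.conj_I]
      congr 1; push_cast; ring
    simp only [neg_neg, Circle.smul_def, smul_eq_mul, map_mul, hc]
  have hi' : Integrable (fun x => conj (u (-x))) :=
    (Complex.conjLIE.toContinuousLinearEquiv.integrable_comp_iff).mpr hi.comp_neg
  rw [weilMellin_half_eq_fourier, weilMellin_half_eq_fourier, autocorr,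
    Real.fourier_mul_convolution_eq hi hi', hconj, mul_conj, normSq_eq_norm_sq]

/-- **`L¹` bound on the window**: `∫ |w| ≤ √(2a) ‖w‖₂` when `w` vanishes off `[-a, a]` a.e.-surely… here under
`supp w ⊆ [-a, a]` (Cauchy–Schwarz against the indicator). [folklore] -/
theorem integral_norm_le_sqrt_mul (ha : 0 ≤ a) {w : ℝ → ℂ} (hw : MemLp w 2 volume)
    (hsw : Function.support w ⊆ Icc (-a) a) : ∫ x, ‖w x‖ ≤ Real.sqrt (2 * a) * N₂ w := by
  set χ : ℝ → ℂ := (Icc (-a) a).indicator fun _ => (1 : ℂ) with hχ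
  have hχm : MemLp χ 2 volume := memLp_indicator_const 2 measurableSet_Icc (1 : ℂ) (Or.inr measure_Icc_lt_top.ne)
  set w' : ℝ → ℂ := fun x => ((‖w x‖ : ℝ) : ℂ) with hw'
  have hw'm : MemLp w' 2 volume :=
    hw.congr_norm (Complex.continuous_ofReal.comp_aestronglyMeasurable hw.1.norm)
      (Eventually.of_forall fun x => by simp [hw'])
  have hprod : ∫ x, χ x * w' x = ((∫ x, ‖w x‖ : ℝ) : ℂ) := by
    rw [← integral_complex_ofReal]
    refine integral_congr_ae (Eventually.of_forall fun x => ?_)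
    by_cases hx : x ∈ Icc (-a) a
    · simp [hχ, hw', indicator_of_mem hx]
    · have : w x = 0 := Function.notMem_support.mp fun h => hx (hsw h)
      simp [hχ, hw', indicator_of_notMem hx, this]
  have h := Literature.Analysis.Fourier.norm_integral_mul_le_eLpNorm_mul hχm hw'm
  rw [hprod, Complex.norm_real, Real.norm_eq_abs, abs_of_nonneg (integral_nonneg fun _ => norm_nonneg _)] at h
  have hχn : N₂ χ = Real.sqrt (2 * a) := by
    have hvol : volume (Icc (-a) a) = ENNReal.ofReal (2 * a) := by rw [Real.volume_Icc]; ring_nf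
    rw [hχ, eLpNorm_indicator_const measurableSet_Icc two_ne_zero ENNReal.ofNat_ne_top, hvol, enorm_one, one_mul,
      ← ENNReal.toReal_rpow, ENNReal.toReal_ofReal (by linarith), ENNReal.toReal_ofNat, Real.sqrt_eq_rpow]
  have hw'n : eLpNorm w' 2 volume = eLpNorm w 2 volume :=
    eLpNorm_congr_norm_ae (Eventually.of_forall fun x => by simp [hw'])
  rwa [hχn, hw'n] at h

/-- **Critical-line values are `√(2a)`-Lipschitz in `‖·‖₂` on the window**:
`|û(1/2+it) − v̂(1/2+it)| ≤ √(2a) ‖u − v‖₂`. [folklore] -/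
theorem norm_weilMellin_half_sub_le (ha : 0 ≤ a) (hu : MemLp u 2 volume) (hv : MemLp v 2 volume)
    (hsu : Function.support u ⊆ Icc (-a) a) (hsv : Function.support v ⊆ Icc (-a) a) (t : ℝ) :
    ‖weilMellin u (1 / 2 + t * I) - weilMellin v (1 / 2 + t * I)‖ ≤ Real.sqrt (2 * a) * N₂ (u - v) := by
  have hsuv : Function.support (u - v) ⊆ Icc (-a) a := by
    intro x hx
    by_contra h
    have h1 : u x = 0 := Function.notMem_support.mp fun h' => h (hsu h')
    have h2 : v x = 0 := Function.notMem_support.mp fun h' => h (hsv h')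
    exact hx (by simp [h1, h2])
  have hiu := integrable_of_memLp_two_of_support hu hsu
  have hiv := integrable_of_memLp_two_of_support hv hsv
  have hI : ∀ {w : ℝ → ℂ}, Integrable w → Integrable (fun x : ℝ => w x * cexp (t * I * x)) := by
    intro w hw
    have h := hw.bdd_mul (c := 1) (by fun_prop : Continuous fun x : ℝ => cexp (t * I * x)).aestronglyMeasurable
      (Eventually.of_forall fun x => by
        rw [show (t : ℂ) * I * x = ((t * x : ℝ) : ℂ) * I by push_cast; ring, Complex.norm_exp_ofReal_mul_I])
    simpa only [mul_comm] using h
  rw [add_comm, weilMellin_add_half, weilMellin_add_half, ← integral_sub (hI hiu) (hI hiv)]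
  calc ‖∫ x, (u x * cexp (t * I * x) - v x * cexp (t * I * x))‖
      ≤ ∫ x, ‖u x * cexp (t * I * x) - v x * cexp (t * I * x)‖ := norm_integral_le_integral_norm _
    _ = ∫ x, ‖(u - v) x‖ := by
        refine integral_congr_ae (Eventually.of_forall fun x => ?_)
        beta_reduce
        rw [← sub_mul, norm_mul, show (t : ℂ) * I * x = ((t * x : ℝ) : ℂ) * I by push_cast; ring,
          Complex.norm_exp_ofReal_mul_I, mul_one, Pi.sub_apply]
    _ ≤ Real.sqrt (2 * a) * N₂ (u - v) := integral_norm_le_sqrt_mul ha (hu.sub hv) hsuv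

/-- **Critical-line values pass to `L²`-limits on the window**: `ĝₙ(1/2+it) → û(1/2+it)` (every `t`; in fact
uniformly). [folklore] -/
theorem tendsto_weilMellin_half (ha : 0 ≤ a) {g : ℕ → ℝ → ℂ} (hg : ∀ n, MemLp (g n) 2 volume)
    (hsg : ∀ n, Function.support (g n) ⊆ Icc (-a) a) (hu : MemLp u 2 volume)
    (hsu : Function.support u ⊆ Icc (-a) a) (hlim : Tendsto (fun n => ∫ x, ‖g n x - u x‖ ^ 2) atTop (𝓝 0))
    (t : ℝ) : Tendsto (fun n => weilMellin (g n) (1 / 2 + t * I)) atTop (𝓝 (weilMellin u (1 / 2 + t * I))) := by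
  have hd : Tendsto (fun n => N₂ (g n - u)) atTop (𝓝 0) := by
    have h1 : Tendsto (fun n => Real.sqrt (∫ x, ‖g n x - u x‖ ^ 2)) atTop (𝓝 0) := by
      have h := (Real.continuous_sqrt.tendsto 0).comp hlim
      rw [Real.sqrt_zero] at h
      exact h
    refine h1.congr fun n => ?_
    rw [toReal_eLpNorm_two_eq_sqrt ((hg n).sub hu)]; rfl
  rw [tendsto_iff_norm_sub_tendsto_zero]
  refine squeeze_zero (fun n => norm_nonneg _)
    (fun n => norm_weilMellin_half_sub_le ha (hg n) hu (hsg n) hsu t) ?_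
  simpa using hd.const_mul (Real.sqrt (2 * a))

/-- **Plancherel on the critical line for `u ∈ L¹ ∩ L²`**: `∫ |û(1/2 + it)|² dt = 2π ∫ |u|²` (the tree's
`integral_norm_sq_weilMellin_half_line`, same proof, hypothesis weakened from `IsWeilTest`). [folklore] -/
theorem integral_norm_sq_weilMellin_half_of_memLp (hi : Integrable u) (h2 : MemLp u 2 volume) :
    ∫ t : ℝ, ‖weilMellin u (1 / 2 + t * I)‖ ^ 2 = 2 * Real.pi * ∫ x, ‖u x‖ ^ 2 := by
  have hP := Literature.Analysis.FunctionSpaces.integral_norm_sq_fourierIntegral_eq hi h2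
  set f : ℝ → ℝ := fun t => ‖weilMellin u (1 / 2 + t * I)‖ ^ 2 with hf
  have hsub := Measure.integral_comp_mul_left f (-(2 * Real.pi))
  have e1 : (fun w : ℝ => f (-(2 * Real.pi) * w)) = fun w => ‖𝓕 u w‖ ^ 2 := by
    funext w
    rw [hf]
    simp only
    rw [weilMellin_half_eq_fourier]
    congr 3
    field_simp
  rw [e1, hP] at hsub
  have hpi : |(-(2 * Real.pi))⁻¹| = (2 * Real.pi)⁻¹ := by
    rw [inv_neg, abs_neg, abs_of_pos (by positivity)]
  rw [hpi, smul_eq_mul] at hsub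
  have h2pi : (0 : ℝ) < 2 * Real.pi := by positivity
  rw [hsub, ← mul_assoc, mul_inv_cancel₀ h2pi.ne', one_mul]

end Summit.RiemannHypothesis.RiemannHypothesis.Theorems.SignCone.DualWitness

end
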